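import Summits.ResolutionOfSingularities.ResolutionOfSingularities.Theorems.EquisingularLiftEquisingularLiftNatIsoHypPointOfPoints
import Summits.ResolutionOfSingularities.ResolutionOfSingularities.Theorems.EquisingularLiftEquisingularLiftNatOccursAsSingularLocus
import Summits.ResolutionOfSingularities.ResolutionOfSingularities.Theorems.FrobeniusLadderFInjectiveMacaulayficationQuotLocalizationIso
import HarnessLib

/-!
# [OURS] THE VERTEX OF A CHART OF MULTIPLICITY ≥ 2 IS A SINGULAR POINT — discharging the stalk hypothesis of the `IsoHypPoint` bridges
# (cruxes `Theses.EquisingularLift.EquisingularLiftNat` / `…NatThree`, stmt-ResolutionOfSingularities-20038 / -20148)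

[OURS · leafhand-res-equisingularlift-10 g0, 2026-08-31; cell `pub/decomp-res`] AI-produced, weaker than expert review; NOT a statement of any manuscript; nothing
here proves resolution of singularities in positive characteristic.  DEF-FREE helper; no `sorry`; standard axioms; ZERO named hypotheses.

The lead's downstairs chain (`IsoHypPoint` = `PointResolvable`) may only blow up NON-REGULAR points, so the bridges ✓ `isoHypPoint_of_oneStepVertex` (p829027),
✓ `isoHypPoint_of_oneStepVertices` (p829346), ✓ `isoHypPoint_of_oneStepPoints_linAut` carry a hypothesis «`V₊(F)` is not regular at the point over the vertex».
This file discharges it from the chart: `F(x_c := 1) = Φ_μ + Ψ` with `μ ≥ 2` ⟹ the local ring at the vertex is `K[y]_{(y)}/(f)` with `0 ≠ f ∈ (y)²`, not regular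
(Matsumura 14.2, ✓ `not_isRegularLocalRing_quotient_span_singleton_of_mem_sq`; chart dictionary ✓ `HypersurfaceSpecimen.exists_chartQuotEquiv`,
✓ `HypersurfaceSpecimen.mem_basicOpen_chart_iff`, ✓ `QuotLocalizationIso.stub_quotLocalizationIso`, Mathlib `StructureSheaf.stalkIso`):

* `mem_pow_span_X_of_isHomogeneous` — a form of degree `μ` lies in `(y)^μ`;
* `isRegularLocalRing_localization_of_stalk_chart` — `𝒪_{V₊(F), chart w}` regular ⟹ `(ChartRing F c)_w` regular (the converse of ✓ `isRegularLocalRing_stalk_chart`);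
* ★★ `not_isRegularLocalRing_stalk_vertex` — **the point of `V₊(F)` over a vertex `P_c` whose chart has multiplicity `μ ≥ 2` is NOT regular** (every field,
  dimension, characteristic);
* ★★ `isoHypPoint_of_singularOneStepVertices` — ✓ `isoHypPoint_of_oneStepVertices` with the stalk hypothesis removed (`μ ≥ 2`): a prime form over `K̄` whose
  singular points are one-step vertices (any list of coordinates) satisfies the lead's hypothesis #7 `IsoHypPoint`.

Honest label: closes no registered stub.  References: [Matsumura1987, Thm. 14.2]; [StacksProject, Tag 01I1]; [Hartshorne1977, I Thm. 5.1] — via the tree files.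
-/

set_option linter.dupNamespace false -- mandated namespace `Summit.<Summit>.<Problem>` of this single-conjunct summit

noncomputable section

open CategoryTheory CategoryTheory.Limits AlgebraicGeometry TopologicalSpace IsLocalRing
open MvPolynomial HomogeneousLocalization
open Literature.AlgebraicGeometry.Resolution Literature.AlgebraicGeometry.Motives
open Literature.AlgebraicGeometry.Motives.SmoothHypersurface Literature.AlgebraicGeometry.Motives.ProjectiveSpace
open AlgebraicGeometry.Scheme.IdealSheafData
open Summit.ResolutionOfSingularities.ResolutionOfSingularities.Cruxes.EquisingularLift.StrataSplit

namespace Summit.ResolutionOfSingularities.ResolutionOfSingularities.Cruxes.EquisingularLiftNat.Sections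

/-- A homogeneous polynomial of degree `μ` lies in `(y)^μ`. [folklore] -/
theorem mem_pow_span_X_of_isHomogeneous {K : Type} [Field K] {n : ℕ} {Φ : MvPolynomial (Fin n) K} {μ : ℕ} (hΦ : Φ.IsHomogeneous μ) :
    Φ ∈ Ideal.span (Set.range (X : Fin n → MvPolynomial (Fin n) K)) ^ μ := by
  change Φ ∈ MvPolynomial.idealOfVars (Fin n) K ^ μ
  refine (MvPolynomial.mem_pow_idealOfVars_iff μ Φ).mpr fun d hd => ?_
  have h := hΦ (mem_support_iff.mp hd)
  rw [Finsupp.degree_eq_weight_one]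
  exact h.symm.le

/-- **A regular stalk at a chart point forces a regular localisation of the chart ring** (`𝒪_{V₊(F), chart w} ≅ (ChartRing F c)_w`: the chart is an open
immersion from `Spec`, and `Spec`'s stalks are the localisations). [cite: StacksProject, Tag 01I1] -/
theorem isRegularLocalRing_localization_of_stalk_chart (K : Type) [Field K] {n : ℕ} (F : MvPolynomial (Fin (n + 2)) K) {d : ℕ}
    (hF : F.IsHomogeneous d) (hd : 0 < d) (c : Fin (n + 2)) :
    letI := MvPolynomial.gradedAlgebra (σ := Fin (n + 2)) (R := K)
    ∀ (w : Spec (CommRingCat.of (ChartRing F c hF))),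
      IsRegularLocalRing ((hypersurface F).left.presheaf.stalk ((chart F c hF hd).left w)) →
      IsRegularLocalRing (Localization.AtPrime w.asIdeal) := by
  letI := MvPolynomial.gradedAlgebra (σ := Fin (n + 2)) (R := K)
  intro w hw
  haveI := hw
  haveI : IsOpenImmersion (chart F c hF hd).left := isOpenImmersion_chart_left F c hF hd
  haveI : IsRegularLocalRing ((Spec (CommRingCat.of (ChartRing F c hF))).presheaf.stalk w) :=
    IsRegularLocalRing.of_ringEquiv (R := (hypersurface F).left.presheaf.stalk ((chart F c hF hd).left w))
      (asIso (((chart F c hF hd).left).stalkMap w)).commRingCatIsoToRingEquiv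
  exact IsRegularLocalRing.of_ringEquiv (R := (Spec (CommRingCat.of (ChartRing F c hF))).presheaf.stalk w)
    (StructureSheaf.stalkIso (CommRingCat.of (ChartRing F c hF)) w).toRingEquiv.symm

/-- ★★ **THE VERTEX OF A CHART OF MULTIPLICITY `μ ≥ 2` IS A NON-REGULAR POINT** — every dimension, every characteristic, every field.  `F` a prime form whose
vertex chart splits as `F(x_c := 1) = Φ + Ψ` with `Φ` a form of degree `μ ≥ 2` and `Ψ ∈ (y)^{μ+1}` (so `F(x_c := 1) ∈ (y)²`); then `V₊(F)` is NOT regular at its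
point over the vertex `P_c`: its local ring is `K[y]_{(y)}/(f)` with `0 ≠ f ∈ (y)²` (✓ `not_isRegularLocalRing_quotient_span_singleton_of_mem_sq`, Matsumura 14.2;
chart dictionary ✓ `HypersurfaceSpecimen.exists_chartQuotEquiv`, ✓ `QuotLocalizationIso.stub_quotLocalizationIso`).  This discharges the hypothesis
`hsingpt` of ✓ `isoHypPoint_of_oneStepVertex` / ✓ `isoHypPoint_of_oneStepVertices` / ✓ `isoHypPoint_of_oneStepPoints_linAut` for every SINGULAR one-step point.
[OURS] [cite: Matsumura1987, Thm. 14.2] [cite: StacksProject, Tag 01I1] -/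
theorem not_isRegularLocalRing_stalk_vertex (K : Type) [Field K] {m : ℕ} (F : MvPolynomial (Fin (m + 2 + 1)) K) {d : ℕ}
    (hF : F.IsHomogeneous d) (hFp : Prime F) (c : Fin (m + 2 + 1))
    (hsplit : ∃ (μ : ℕ) (Φ Ψ : MvPolynomial (Fin (m + 2)) K), 2 ≤ μ ∧ Φ.IsHomogeneous μ ∧
      Ψ ∈ Ideal.span (Set.range (X : Fin (m + 2) → MvPolynomial (Fin (m + 2)) K)) ^ (μ + 1) ∧ ProjectiveSpace.dehomogenize K c F = Φ + Ψ) :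
    letI := MvPolynomial.gradedAlgebra (σ := Fin (m + 2 + 1)) (R := K)
    ∀ x : ↥(hypersurface F).left,
      (∀ a : Fin (m + 2 + 1), a ≠ c → (X a : MvPolynomial (Fin (m + 2 + 1)) K) ∈ ((hypersurfaceι F).left x).asHomogeneousIdeal) →
      ¬ IsRegularLocalRing ((hypersurface F).left.presheaf.stalk x) := by
  letI := MvPolynomial.gradedAlgebra (σ := Fin (m + 2 + 1)) (R := K)
  intro x hxv hreg
  obtain ⟨μ, Φ, Ψ, hμ, hΦ, hΨ, hdeh⟩ := hsplit
  have hd : 0 < d := ConeN.pos_of_prime_of_isHomogeneous K F hF hFp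
  set f := Φ + Ψ with hf
  -- `f ≠ 0`, `f ∈ (y)²`, `(f)` radical
  have hrad : (Ideal.span {f}).radical = Ideal.span {f} := OrdPointAt.radical_span_dehomogenize_eq K F c hF hFp Φ Ψ hΦ (by omega) hΨ hdeh
  have hf0 : f ≠ 0 := by
    rw [← hdeh]
    rcases ProjectiveSpace.irreducible_or_isUnit_dehomogenize (i := c) hF hFp.irreducible with hirr | hu
    · exact hirr.ne_zero
    · exact hu.ne_zero
  have hf2 : f ∈ Ideal.span (Set.range (X : Fin (m + 2) → MvPolynomial (Fin (m + 2)) K)) ^ 2 :=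
    Ideal.add_mem _ (Ideal.pow_le_pow_right hμ (mem_pow_span_X_of_isHomogeneous hΦ)) (Ideal.pow_le_pow_right (by omega) hΨ)
  -- `x` lies in the chart `D₊(x_c)`
  have hXc : (X c : MvPolynomial (Fin (m + 2 + 1)) K) ∉ ((hypersurfaceι F).left x).asHomogeneousIdeal := by
    intro hc
    apply ((hypersurfaceι F).left x).not_irrelevant_le
    intro q hq
    have hall : ∀ i : Fin (m + 2 + 1), (X i : MvPolynomial (Fin (m + 2 + 1)) K) ∈ ((hypersurfaceι F).left x).asHomogeneousIdeal := fun i => by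
      by_cases hic : i = c
      · rw [hic]; exact hc
      · exact hxv i hic
    have hle : Ideal.span (Set.range (X : Fin (m + 2 + 1) → MvPolynomial (Fin (m + 2 + 1)) K)) ≤
        ((hypersurfaceι F).left x).asHomogeneousIdeal.toIdeal := Ideal.span_le.mpr (Set.range_subset_iff.mpr hall)
    exact hle (Segre.irrelevant_le_span_X (Fin (m + 2 + 1)) K hq)
  have hxr : x ∈ Set.range (chart F c hF hd).left := by
    rw [range_chart_left]
    exact (Proj.mem_basicOpen _ _ _).mpr hXc
  obtain ⟨w, rfl⟩ := hxr
  -- the killed variables lie in `𝔮_w`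
  have htaut : ∀ j : Fin (m + 2), tautVec F c hF (c.succAbove j) ∈ w.asIdeal := by
    intro j
    by_contra h
    have h' := (HypersurfaceSpecimen.mem_basicOpen_chart_iff K F hF hd c (c.succAbove j) w).mpr h
    exact (Proj.mem_basicOpen _ _ _).mp h' (hxv _ (Fin.succAbove_ne c j))
  -- move to `K[y]/(f)`
  obtain ⟨θ, hθ⟩ := HypersurfaceSpecimen.exists_chartQuotEquiv F hF c f hdeh hrad
  obtain ⟨𝔮', h𝔮'⟩ : ∃ P : Ideal (MvPolynomial (Fin (m + 2)) K ⧸ Ideal.span {f}), P = w.asIdeal.comap θ.symm.toRingHom := ⟨_, rfl⟩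
  haveI : 𝔮'.IsPrime := by rw [h𝔮']; exact Ideal.comap_isPrime _ _
  have hmem : ∀ q, q ∈ 𝔮' ↔ θ.symm q ∈ w.asIdeal := fun q => by rw [h𝔮', Ideal.mem_comap]; rfl
  have hregq : IsRegularLocalRing (Localization.AtPrime 𝔮') :=
    OrdPoint.isRegularLocalRing_localization_of_ringEquiv θ w.asIdeal 𝔮'
      (fun y => by rw [hmem, RingEquiv.symm_apply_apply]) (isRegularLocalRing_localization_of_stalk_chart K F hF hd c w hreg)
  -- the prime `P ⊇ (y)` of `K[y]` under `𝔮'`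
  obtain ⟨P, hP⟩ : ∃ P : Ideal (MvPolynomial (Fin (m + 2)) K), P = 𝔮'.comap (Ideal.Quotient.mk (Ideal.span {f})) := ⟨_, rfl⟩
  haveI : P.IsPrime := by rw [hP]; exact Ideal.comap_isPrime _ _
  have hXP : ∀ j : Fin (m + 2), (X j : MvPolynomial (Fin (m + 2)) K) ∈ P := fun j => by
    rw [hP, Ideal.mem_comap, hmem, ← hθ j, RingEquiv.symm_apply_apply]
    exact htaut j
  have hfP2 : f ∈ P ^ 2 := Ideal.pow_right_mono (Ideal.span_le.mpr (Set.range_subset_iff.mpr hXP)) 2 hf2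
  -- `(K[y]/(f))_{𝔮'} ≅ K[y]_P / (f)` is not regular
  obtain ⟨e⟩ := Summit.ResolutionOfSingularities.ResolutionOfSingularities.Theorems.FInjectiveMacaulayfication.QuotLocalizationIso.stub_quotLocalizationIso
    (MvPolynomial (Fin (m + 2)) K) f P 𝔮' hP.symm
  haveI : IsRegularRing (MvPolynomial (Fin (m + 2)) K) := inferInstance
  haveI : IsRegularLocalRing (Localization.AtPrime P) := IsRegularRing.isRegularLocalRing_localization P
  have hinj : Function.Injective (algebraMap (MvPolynomial (Fin (m + 2)) K) (Localization.AtPrime P)) :=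
    IsLocalization.injective (Localization.AtPrime P) (Ideal.primeCompl_le_nonZeroDivisors P)
  have h0 : algebraMap (MvPolynomial (Fin (m + 2)) K) (Localization.AtPrime P) f ≠ 0 := fun h =>
    hf0 (hinj (by rw [h, map_zero]))
  have h2 : algebraMap (MvPolynomial (Fin (m + 2)) K) (Localization.AtPrime P) f ∈ maximalIdeal (Localization.AtPrime P) ^ 2 := by
    rw [← Localization.AtPrime.map_eq_maximalIdeal, ← Ideal.map_pow]
    exact Ideal.mem_map_of_mem _ hfP2
  have hnot := not_isRegularLocalRing_quotient_span_singleton_of_mem_sq h0 h2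
  haveI := hregq
  exact hnot (IsRegularLocalRing.of_ringEquiv (R := Localization.AtPrime 𝔮') e.symm)


/-- ★★ **SEVERAL SINGULAR ONE-STEP VERTICES ⟹ `IsoHypPoint`, with no stalk hypothesis** (`K = K̄`; ✓ `isoHypPoint_of_oneStepVertices` with its hypothesis
`hsingpt` discharged by `not_isRegularLocalRing_stalk_vertex`): `F` a prime form; `S` ANY list of coordinates; for `c ∈ S` the vertex chart `F(x_c := 1) = Φ + Ψ`
with `Φ ≠ 0` a form of degree `μ ≥ 2` (a SINGULAR point), `Ψ ∈ (y)^{μ+1}`, explicit strict transforms `G_l` with a Jacobian certificate (seat res-D-pv-013's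
ONE-STEP datum), singular at most at the origin; charts `c ∉ S` regular.  Then `IsoHypPoint K (m+2) V₊(F) ι` — the lead's hypothesis #7 (= `PointResolvable`).
E.g. every hypersurface whose singular points are `A₁` / `A₂` / ordinary multiple points sitting at coordinate vertices (with ✓ `FirstOrderPoint.exists_strictTransform`
for the `G_l`). [OURS] [cite: Hartshorne1977, I Thm. 5.1] [cite: Matsumura1987, Thm. 14.2] -/
theorem isoHypPoint_of_singularOneStepVertices (K : Type) [Field K] [IsAlgClosed K] {m : ℕ}
    (F : MvPolynomial (Fin (m + 2 + 1)) K) {d : ℕ} (hF : F.IsHomogeneous d) (hFp : Prime F)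
    (S : List (Fin (m + 2 + 1)))
    (hone : ∀ c ∈ S, ∃ (μ : ℕ) (Φ Ψ : MvPolynomial (Fin (m + 2)) K), 2 ≤ μ ∧ Φ.IsHomogeneous μ ∧ Φ ≠ 0 ∧
      Ψ ∈ Ideal.span (Set.range (X : Fin (m + 2) → MvPolynomial (Fin (m + 2)) K)) ^ (μ + 1) ∧ ProjectiveSpace.dehomogenize K c F = Φ + Ψ ∧
      ∀ l : Fin (m + 2), ∃ G : MvPolynomial (Fin (m + 2)) K,
        aeval (fun j => X l * Function.update (X : Fin (m + 2) → MvPolynomial (Fin (m + 2)) K) l 1 j) (Φ + Ψ) = X l ^ μ * G ∧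
        ∀ P : Ideal (MvPolynomial (Fin (m + 2)) K), P.IsPrime → (X l : MvPolynomial (Fin (m + 2)) K) ∈ P → G ∈ P → ∃ j, pderiv j G ∉ P)
    (hsing : ∀ c ∈ S, ∀ P : Ideal (MvPolynomial (Fin (m + 2)) K), P.IsPrime → ProjectiveSpace.dehomogenize K c F ∈ P →
      (∀ j, pderiv j (ProjectiveSpace.dehomogenize K c F) ∈ P) → ∀ j, (X j : MvPolynomial (Fin (m + 2)) K) ∈ P)
    (hoff : letI := MvPolynomial.gradedAlgebra (σ := Fin (m + 2 + 1)) (R := K)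
      ∀ c, c ∉ S → IsRegularRing (ChartRing F c hF)) :
    letI := MvPolynomial.gradedAlgebra (σ := Fin (m + 2 + 1)) (R := K)
    IsoHypPoint K (m + 2) (hypersurface F).left (hypersurfaceι F).left := by
  letI := MvPolynomial.gradedAlgebra (σ := Fin (m + 2 + 1)) (R := K)
  refine isoHypPoint_of_oneStepVertices K F hF hFp S (fun c hc => ?_) hsing (fun c hc x hx => ?_) hoff
  · obtain ⟨μ, Φ, Ψ, hμ, hΦ, hΦ0, hΨ, hdeh, hG⟩ := hone c hc
    exact ⟨μ, Φ, Ψ, by omega, hΦ, hΦ0, hΨ, hdeh, hG⟩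
  · obtain ⟨μ, Φ, Ψ, hμ, hΦ, -, hΨ, hdeh, -⟩ := hone c hc
    exact not_isRegularLocalRing_stalk_vertex K F hF hFp c ⟨μ, Φ, Ψ, hμ, hΦ, hΨ, hdeh⟩ x hx

end Summit.ResolutionOfSingularities.ResolutionOfSingularities.Cruxes.EquisingularLiftNat.Sections

end
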